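import Summits.Schanuel.Schanuel.Theses.MisiurewiczField

/-!
# Birth skeleton (BC3) — crux stmt-Schanuel-12572 `MisiurewiczField.MisiurewiczSector`
# Line `birth` (orbit-by-orbit induction on the Misiurewicz span)

Crux (X1 of route `MisiurewiczField`): Schanuel's conjecture for `ℚ`-linearly independent tuples
`x` taken from `V = span_ℚ M`, `M = {a_{j+1}(l) : l post-singularly finite, j ≥ 0}` the set of
post-singular orbit points of all Misiurewicz parameters of `E_l(z) = l e^z`
(`a_1(l) = l`, `a_{j+1}(l) = l e^{a_j(l)}`): `n ≤ trdeg_ℚ ℚ(x, eˣ)`.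

TRANSFER (proved below, `sector_of_spanFree`): because the conclusion only needs
`trdeg ℚ(x, eˣ) ≥ n`, it suffices that `x` itself be ALGEBRAICALLY INDEPENDENT over `ℚ`
(`AlgebraicIndependent.cardinalMk_le_trdeg` inside `ℚ(x, eˣ)`).  The exponential disappears:
the line attacks the EXPONENTIAL-FREE form "on `span_ℚ M`, `ℚ`-linear independence ⇒ algebraic
independence" — a statement about the countable, combinatorially indexed point set `M` alone
(integer external addresses, step equations `a_n − a_m ∈ 2πiℤ`), which is the form in which the
dynamical data of the route (addresses, transversality, depth) can enter.  (Conversely the crux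
gives this form back, because `e^{a_j} = a_{j+1}/a_1 ∈ ℚ(M)`; not needed here.)

The exponential-free form is organised ONE ORBIT AT A TIME (induction over finite sets of
parameters; every tuple in `span_ℚ M` has finite support — proved below, `MisiurewiczSector_of`):

* `stub_orbitFree` (OPEN, base; "the post-singular orbit of a Misiurewicz exponential map is
  algebraically free"): for ONE post-singularly finite `l`, every `ℚ`-linearly independent tuple in
  `span_ℚ {a_1(l), a_2(l), …}` is algebraically independent over `ℚ`.  Rank-1 orbits
  (`l ∈ πiℤ`, types (1,1), (2,1)-lattice) = transcendence of `π` (tree: `transcendental_pi`);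
  the first open cell is rank 2: `l e^l = 2πik` (type (1,2)), i.e. `π ⊥ W_k(2πik)`.
  It is the unconditional form of the route's support `OrbitFreenessOfSector` (which derives it
  FROM the crux); here it is an INPUT.
* `stub_orbitJoin` (OPEN, step; "relative freeness of one more orbit"): if the span of the orbits
  of a NONEMPTY finite set `P` of Misiurewicz parameters is algebraically free in the above sense,
  so is the span of the orbits of `P ∪ {l}` for any further Misiurewicz `l`.  Its natural proof is
  a RELATIVE Schanuel statement for one Misiurewicz orbit over the finitely generated field
  `ℚ(O(P))` (tower additivity of `Algebra.trdeg`); `P.Nonempty` keeps it disjoint from the base.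

Composition (kernel-checked, no `sorry` outside the two stubs): `Finset.Nonempty.cons_induction`
(base = `stub_orbitFree`, step = `stub_orbitJoin`) gives freeness of the span of the orbits of
every nonempty finite set of Misiurewicz parameters; a tuple in `span_ℚ M` has finite support
(`Submodule.mem_span_finite_of_mem_span`), covered by finitely many parameters (plus the dummy
Misiurewicz parameter `πi`, `isPostsingularlyFinite_pi_mul_I`, to keep the set nonempty); then the
transfer.  `MisiurewiczSector_of` concludes the crux BY NAME; `MisiurewiczSector_of_stubs` is the
same composition with the two stub statements as explicit hypotheses.

Disproof used: none relevant (no `Disproof.lean` exists for this crux at registration time;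
`ledger negatives --problem Schanuel` has no statement about Misiurewicz spans).
-/

namespace Summit.Schanuel.Schanuel.Cruxes.MisiurewiczSector.Birth

set_option linter.dupNamespace false

open Summit.Schanuel.Schanuel.Theses
open Literature.Dynamics.ExponentialFamily

/-- STUB 1 (OPEN, base of the induction): **single-orbit freeness** — for a post-singularly finite
parameter `l`, every `ℚ`-linearly independent tuple in the `ℚ`-span of its post-singular orbit
`{a_{j+1}(l) : j ≥ 0}` is algebraically independent over `ℚ`. -/
theorem stub_orbitFree :
    ∀ l : ℂ, Literature.Dynamics.ExponentialFamily.IsPostsingularlyFinite l →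
      ∀ (n : ℕ) (x : Fin n → ℂ),
        (∀ i, x i ∈ Submodule.span ℚ {w : ℂ | ∃ j : ℕ,
          w = Literature.Dynamics.ExponentialFamily.postsingularOrbit l (j + 1)}) →
        LinearIndependent ℚ x → AlgebraicIndependent ℚ x := by
  sorry

/-- STUB 2 (OPEN, induction step): **orbit join** — if the `ℚ`-span of the orbits of a nonempty
finite set `P` of post-singularly finite parameters is algebraically free (`ℚ`-linearly independent
tuples are algebraically independent), then so is the `ℚ`-span of the orbits of `P ∪ {l}` for every
further post-singularly finite `l`. -/
theorem stub_orbitJoin :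
    ∀ (P : Finset ℂ) (l : ℂ), P.Nonempty →
      (∀ l' ∈ P, Literature.Dynamics.ExponentialFamily.IsPostsingularlyFinite l') →
      Literature.Dynamics.ExponentialFamily.IsPostsingularlyFinite l →
      (∀ (n : ℕ) (x : Fin n → ℂ),
        (∀ i, x i ∈ Submodule.span ℚ {w : ℂ | ∃ l' ∈ P, ∃ j : ℕ,
          w = Literature.Dynamics.ExponentialFamily.postsingularOrbit l' (j + 1)}) →
        LinearIndependent ℚ x → AlgebraicIndependent ℚ x) →
      ∀ (n : ℕ) (x : Fin n → ℂ),
        (∀ i, x i ∈ Submodule.span ℚ {w : ℂ | ∃ l' : ℂ, (l' = l ∨ l' ∈ P) ∧ ∃ j : ℕ,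
          w = Literature.Dynamics.ExponentialFamily.postsingularOrbit l' (j + 1)}) →
        LinearIndependent ℚ x → AlgebraicIndependent ℚ x := by
  sorry

/-! ### Composition (proved) -/

/-- TRANSFER (proved): an algebraically independent tuple `x` forces `trdeg_ℚ ℚ(x, eˣ) ≥ n`. -/
theorem sector_of_algebraicIndependent {n : ℕ} {x : Fin n → ℂ} (hai : AlgebraicIndependent ℚ x) :
    (n : Cardinal) ≤ Algebra.trdeg ℚ
      ↥(IntermediateField.adjoin ℚ (Set.range x ∪ Set.range (Complex.exp ∘ x))) := by
  have hmem : ∀ i, x i ∈ IntermediateField.adjoin ℚ (Set.range x ∪ Set.range (Complex.exp ∘ x)) :=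
    fun i => IntermediateField.subset_adjoin ℚ _ (Or.inl ⟨i, rfl⟩)
  let x' : Fin n → ↥(IntermediateField.adjoin ℚ (Set.range x ∪ Set.range (Complex.exp ∘ x))) :=
    fun i => ⟨x i, hmem i⟩
  have hai' : AlgebraicIndependent ℚ x' :=
    AlgebraicIndependent.of_comp
      (IntermediateField.adjoin ℚ (Set.range x ∪ Set.range (Complex.exp ∘ x))).val hai
  simpa using hai'.cardinalMk_le_trdeg

/-- INDUCTION (proved from the two stubs): the span of the orbits of every nonempty finite set of
post-singularly finite parameters is algebraically free. -/
theorem spanFree_finset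
    (hbase : ∀ l : ℂ, IsPostsingularlyFinite l →
      ∀ (n : ℕ) (x : Fin n → ℂ),
        (∀ i, x i ∈ Submodule.span ℚ {w : ℂ | ∃ j : ℕ, w = postsingularOrbit l (j + 1)}) →
        LinearIndependent ℚ x → AlgebraicIndependent ℚ x)
    (hjoin : ∀ (P : Finset ℂ) (l : ℂ), P.Nonempty →
      (∀ l' ∈ P, IsPostsingularlyFinite l') → IsPostsingularlyFinite l →
      (∀ (n : ℕ) (x : Fin n → ℂ),
        (∀ i, x i ∈ Submodule.span ℚ {w : ℂ | ∃ l' ∈ P, ∃ j : ℕ,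
          w = postsingularOrbit l' (j + 1)}) →
        LinearIndependent ℚ x → AlgebraicIndependent ℚ x) →
      ∀ (n : ℕ) (x : Fin n → ℂ),
        (∀ i, x i ∈ Submodule.span ℚ {w : ℂ | ∃ l' : ℂ, (l' = l ∨ l' ∈ P) ∧ ∃ j : ℕ,
          w = postsingularOrbit l' (j + 1)}) →
        LinearIndependent ℚ x → AlgebraicIndependent ℚ x)
    {P : Finset ℂ} (hP : P.Nonempty) :
    (∀ l ∈ P, IsPostsingularlyFinite l) →
      ∀ (n : ℕ) (x : Fin n → ℂ),
        (∀ i, x i ∈ Submodule.span ℚ {w : ℂ | ∃ l ∈ P, ∃ j : ℕ, w = postsingularOrbit l (j + 1)}) →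
        LinearIndependent ℚ x → AlgebraicIndependent ℚ x := by
  induction hP using Finset.Nonempty.cons_induction with
  | singleton a =>
    intro hM n x hx hli
    refine hbase a (hM a (Finset.mem_singleton_self a)) n x (fun i => ?_) hli
    have hset : {w : ℂ | ∃ l ∈ ({a} : Finset ℂ), ∃ j : ℕ, w = postsingularOrbit l (j + 1)} =
        {w : ℂ | ∃ j : ℕ, w = postsingularOrbit a (j + 1)} := by
      ext w
      simp
    rw [← hset]
    exact hx i
  | cons a s ha hs ih =>
    intro hM n x hx hli
    have hMs : ∀ l ∈ s, IsPostsingularlyFinite l :=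
      fun l hl => hM l (Finset.mem_cons.mpr (Or.inr hl))
    have hMa : IsPostsingularlyFinite a := hM a (Finset.mem_cons_self a s)
    refine hjoin s a hs hMs hMa (ih hMs) n x (fun i => ?_) hli
    have hset : {w : ℂ | ∃ l ∈ Finset.cons a s ha, ∃ j : ℕ, w = postsingularOrbit l (j + 1)} =
        {w : ℂ | ∃ l' : ℂ, (l' = a ∨ l' ∈ s) ∧ ∃ j : ℕ, w = postsingularOrbit l' (j + 1)} := by
      ext w
      simp only [Set.mem_setOf_eq, Finset.mem_cons]
    rw [← hset]
    exact hx i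

/-- COMPOSITION with the stub statements as explicit hypotheses (real proof, no `sorry`):
single-orbit freeness + orbit join ⟹ the crux `MisiurewiczSector`. -/
theorem MisiurewiczSector_of_stubs
    (hbase : ∀ l : ℂ, IsPostsingularlyFinite l →
      ∀ (n : ℕ) (x : Fin n → ℂ),
        (∀ i, x i ∈ Submodule.span ℚ {w : ℂ | ∃ j : ℕ, w = postsingularOrbit l (j + 1)}) →
        LinearIndependent ℚ x → AlgebraicIndependent ℚ x)
    (hjoin : ∀ (P : Finset ℂ) (l : ℂ), P.Nonempty →
      (∀ l' ∈ P, IsPostsingularlyFinite l') → IsPostsingularlyFinite l →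
      (∀ (n : ℕ) (x : Fin n → ℂ),
        (∀ i, x i ∈ Submodule.span ℚ {w : ℂ | ∃ l' ∈ P, ∃ j : ℕ,
          w = postsingularOrbit l' (j + 1)}) →
        LinearIndependent ℚ x → AlgebraicIndependent ℚ x) →
      ∀ (n : ℕ) (x : Fin n → ℂ),
        (∀ i, x i ∈ Submodule.span ℚ {w : ℂ | ∃ l' : ℂ, (l' = l ∨ l' ∈ P) ∧ ∃ j : ℕ,
          w = postsingularOrbit l' (j + 1)}) →
        LinearIndependent ℚ x → AlgebraicIndependent ℚ x) :
    MisiurewiczField.MisiurewiczSector := by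
  intro n x hx hli
  classical
  refine sector_of_algebraicIndependent ?_
  -- finite support of the tuple inside `M`
  have hfin : ∀ i, ∃ T : Finset ℂ,
      (↑T : Set ℂ) ⊆ {w : ℂ | ∃ l : ℂ, IsPostsingularlyFinite l ∧ ∃ j : ℕ,
        w = postsingularOrbit l (j + 1)} ∧
      x i ∈ Submodule.span ℚ (↑T : Set ℂ) :=
    fun i => Submodule.mem_span_finite_of_mem_span (hx i)
  choose T hTsub hxT using hfin
  have hU : ∀ w ∈ Finset.univ.biUnion T, ∃ l : ℂ, IsPostsingularlyFinite l ∧ ∃ j : ℕ,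
      w = postsingularOrbit l (j + 1) := by
    intro w hw
    obtain ⟨i, -, hi⟩ := Finset.mem_biUnion.mp hw
    exact hTsub i hi
  choose! p hp j hj using hU
  -- the covering finite set of parameters (with the dummy Misiurewicz parameter `πi`)
  let P : Finset ℂ := insert ((Real.pi : ℂ) * Complex.I) ((Finset.univ.biUnion T).image p)
  have hPne : P.Nonempty := Finset.insert_nonempty _ _
  have hPM : ∀ l ∈ P, IsPostsingularlyFinite l := by
    intro l hl
    rcases Finset.mem_insert.mp hl with rfl | hl
    · exact isPostsingularlyFinite_pi_mul_I
    · obtain ⟨w, hw, rfl⟩ := Finset.mem_image.mp hl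
      exact hp w hw
  have hxP : ∀ i, x i ∈ Submodule.span ℚ
      {w : ℂ | ∃ l ∈ P, ∃ j : ℕ, w = postsingularOrbit l (j + 1)} := by
    intro i
    refine Submodule.span_mono (fun w hw => ?_) (hxT i)
    have hwU : w ∈ Finset.univ.biUnion T := Finset.mem_biUnion.mpr ⟨i, Finset.mem_univ i, hw⟩
    exact ⟨p w, Finset.mem_insert_of_mem (Finset.mem_image_of_mem p hwU), j w, hj w hwU⟩
  exact spanFree_finset hbase hjoin hPne hPM n x hxP hli

/-- `MisiurewiczSector_of` concludes the crux BY NAME from the two registered stubs. -/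
theorem MisiurewiczSector_of : MisiurewiczField.MisiurewiczSector :=
  MisiurewiczSector_of_stubs stub_orbitFree stub_orbitJoin

end Summit.Schanuel.Schanuel.Cruxes.MisiurewiczSector.Birth
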